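import Summits.HodgeConjecture.HodgeConjecture.Theses.NodalThetaWeil

/-!
# Route NodalThetaWeil — `WeilSixfoldsOfNodalTheta` (glue item stmt-HodgeConjecture-14234)

`NodalThetaSupport → NodeDualClassesAlgebraic → WeilSixfolds`: on a Weil sixfold the first crux puts
the rational `(3,3)`-class (split into its two eigen-components for `x + y φ`) into `N¹H⁶`, the second
makes such divisor-supported classes algebraic; `WeilSixfolds` is their composition (the three decls
share their hypotheses verbatim).  Pure logic — the route file itself marks this item "Difficulty XS";
no other import, no named-fact hypothesis, no sorry.
-/

-- `Summit.HodgeConjecture.HodgeConjecture.Theorems` is the mandated namespace (single-problem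
-- summit: Problem = Summit), which `linter.dupNamespace` flags on every declaration; the lakefile
-- turns the linter off tree-wide (weak option), restated here so stand-alone elaboration is
-- warning-free too.
set_option linter.dupNamespace false

namespace Summit.HodgeConjecture.HodgeConjecture.Theorems

/-- **Item stmt-HodgeConjecture-14234 (`WeilSixfoldsOfNodalTheta`), route `NodalThetaWeil`**:
compose `NodalThetaSupport` (coniveau `≥ 1`) with `NodeDualClassesAlgebraic` (supported ⟹ algebraic).
[cite: Thomas2005Nodes, §2] -/
theorem nodalThetaWeil_weilSixfoldsOfNodalTheta_proof :
    Summit.HodgeConjecture.HodgeConjecture.Theses.NodalThetaWeil.WeilSixfoldsOfNodalTheta :=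
  fun h₁ h₂ d hd A φ hdim hX hφ c hc hH hE ↦
    h₂ d hd A φ hdim hX hφ c hc hH hE (h₁ d hd A φ hdim hX hφ c hc hH hE)

end Summit.HodgeConjecture.HodgeConjecture.Theorems
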